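import Summits.Ventures.PercRepro.S1CoreSixPlane

/-!
# PercRepro — the 4-circuits through two points inside one plane (p1, gen 21; the s₄ seat)

`proofs/P1-S4-PERPOINT.md` §3. Fix two points `e ≠ x` of the e-free core and the line `L₀ := cl {e, x}`. A
4-circuit `C ∋ e, x` meets `L₀` exactly in `{e, x}` (`fourCircuit_inter_closure_pair`), so inside a plane `P ⊇ L₀`
the 4-circuits through `e, x` are determined by their two points in `K := P ∖ L₀`: at most `C(|K|, 2)` of them.
When `|K| = 4` the plane has 6 points and `S1CoreSixPlane` gives a rank-`2` triple through `e` and one through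
`x` inside `P`; their pairs are two distinct pairs of `K` that carry no circuit, so at most `6 − 2 = 4` remain.
Hence, in every case, `2·#(4-circuits through e, x in P) + 3 ≤ 3·|K|` (`two_mul_ncard_fourCircuits_in_plane_le`):
`|K| = 2 / 3 / 4` carry at most `1 / 3 / 4`.
Axioms: standard.
-/

open scoped Matroid

namespace PercRepro

namespace S1

open Set

variable {α : Type}

/-- The 2-subsets of a finite set `K` number `C(|K|, 2)`. -/
theorem ncard_pairs (K : Set α) (hK : K.Finite) :
    {S : Set α | S ⊆ K ∧ S.ncard = 2}.ncard = K.ncard.choose 2 := by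
  classical
  have himg : {S : Set α | S ⊆ K ∧ S.ncard = 2} =
      (fun s : Finset α => (s : Set α)) '' ((hK.toFinset.powersetCard 2 : Finset (Finset α)) : Set (Finset α)) := by
    ext S
    simp only [mem_setOf_eq, mem_image, Finset.mem_coe, Finset.mem_powersetCard]
    constructor
    · rintro ⟨hSK, hS2⟩
      have hSfin : S.Finite := hK.subset hSK
      refine ⟨hSfin.toFinset, ⟨?_, ?_⟩, hSfin.coe_toFinset⟩
      · exact (Set.Finite.toFinset_subset_toFinset).2 hSK
      · rw [← ncard_eq_toFinset_card S hSfin]; exact hS2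
    · rintro ⟨s, ⟨hsK, hs2⟩, rfl⟩
      refine ⟨?_, ?_⟩
      · intro a ha
        exact hK.mem_toFinset.1 (hsK (Finset.mem_coe.1 ha))
      · rw [ncard_coe_finset]; exact hs2
  rw [himg, ncard_image_of_injective _ Finset.coe_injective, ncard_coe_finset, Finset.card_powersetCard,
    ncard_eq_toFinset_card K hK]

/-- A 4-circuit through `e, x` meets `cl {e, x}` exactly in `{e, x}` (a third point would give a dependent
proper subset), and its two other points are outside `cl {e, x}`. -/
theorem fourCircuit_inter_closure_pair (M : Matroid α) {C : Set α} (hC : M.IsCircuit C) (h4 : C.ncard = 4)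
    {e x : α} (he : e ∈ C) (hx : x ∈ C) (hex : e ≠ x) :
    C ∩ M.closure {e, x} = {e, x} ∧ (C \ M.closure {e, x}).ncard = 2 := by
  have hCfin : C.Finite := finite_of_ncard_pos (by omega)
  have hex' : ({e, x} : Set α) ⊆ C := by
    intro t ht; simp only [mem_insert_iff, mem_singleton_iff] at ht; rcases ht with rfl | rfl; exact he; exact hx
  have hsub : ({e, x} : Set α) ⊆ M.closure {e, x} := M.subset_closure _ (hex'.trans hC.subset_ground)
  have hinter : C ∩ M.closure {e, x} = {e, x} := by
    apply Subset.antisymm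
    · intro w hw
      by_contra hwex
      -- `{e, x, w} ⊆ C` is a proper subset of `C`, hence independent, of rank 3; but it lies in `cl {e, x}` of rank 2
      have hT : ({e, x, w} : Set α) ⊆ C := by
        intro t ht; simp only [mem_insert_iff, mem_singleton_iff] at ht
        rcases ht with rfl | rfl | rfl; exact he; exact hx; exact hw.1
      have hTss : ({e, x, w} : Set α) ⊂ C := by
        refine ⟨hT, fun hCT => ?_⟩
        have : C.ncard ≤ ({e, x, w} : Set α).ncard := ncard_le_ncard hCT (toFinite _)
        have h3 : ({e, x, w} : Set α).ncard ≤ 3 := by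
          calc ({e, x, w} : Set α).ncard ≤ ({x, w} : Set α).ncard + 1 := ncard_insert_le _ _
            _ ≤ ({w} : Set α).ncard + 1 + 1 := by have := ncard_insert_le x ({w} : Set α); omega
            _ = 3 := by rw [ncard_singleton]
        omega
      have hind := hC.ssubset_indep hTss
      have hwe : w ≠ e := fun h => hwex (by simp [h])
      have hwx : w ≠ x := fun h => hwex (by simp [h])
      have hT3 : ({e, x, w} : Set α).ncard = 3 := ncard_eq_three.2 ⟨e, x, w, hex, hwe.symm, hwx.symm, rfl⟩
      have hrk : M.eRk {e, x, w} = 3 := by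
        rw [hind.eRk_eq_encard, ← Set.Finite.cast_ncard_eq (toFinite _), hT3]; rfl
      have hle : M.eRk {e, x, w} ≤ M.eRk (M.closure {e, x}) := by
        apply M.eRk_mono
        intro t ht; simp only [mem_insert_iff, mem_singleton_iff] at ht
        rcases ht with rfl | rfl | rfl
        · exact hsub (by simp)
        · exact hsub (by simp)
        · exact hw.2
      rw [M.eRk_closure_eq, hrk] at hle
      have h2 : M.eRk {e, x} ≤ 2 := by
        refine (M.eRk_le_encard _).trans ?_
        rw [← Set.Finite.cast_ncard_eq (toFinite _), ncard_pair hex]; rfl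
      have : (3 : ℕ∞) ≤ 2 := hle.trans h2
      exact absurd this (by decide)
    · exact subset_inter hex' hsub
  refine ⟨hinter, ?_⟩
  have h1 : (C ∩ M.closure {e, x}).ncard + (C \ M.closure {e, x}).ncard = C.ncard :=
    ncard_inter_add_ncard_sdiff_eq_ncard C (M.closure {e, x}) hCfin
  rw [hinter, ncard_pair hex] at h1
  omega

/-- **The 4-circuits through `e, x` inside a plane `P ⊇ cl {e, x}`**: with `K := P ∖ cl {e, x}` and at least one
such circuit, `2·#(4-circuits through e, x in P) + 3 ≤ 3·|K|`. -/
theorem two_mul_ncard_fourCircuits_in_plane_le (M : Matroid α) [M.Finite]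
    (hfree : ∀ e ∈ M.E, ∃ A ⊆ M.E \ {e}, e ∉ M.closure A ∧ e ∉ M.closure ((M.E \ {e}) \ A))
    {e x : α} (hex : e ≠ x) {P : Set α} (hP : P ⊆ M.E) (hrP : M.eRk P ≤ 3)
    (hL : M.closure {e, x} ⊆ P)
    (hne : {C : Set α | M.IsCircuit C ∧ C.ncard = 4 ∧ e ∈ C ∧ x ∈ C ∧ C ⊆ P}.Nonempty) :
    2 * {C : Set α | M.IsCircuit C ∧ C.ncard = 4 ∧ e ∈ C ∧ x ∈ C ∧ C ⊆ P}.ncard + 3 ≤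
      3 * (P \ M.closure {e, x}).ncard := by
  classical
  set L₀ := M.closure {e, x} with hL₀
  set K := P \ L₀ with hK
  set 𝒞 := {C : Set α | M.IsCircuit C ∧ C.ncard = 4 ∧ e ∈ C ∧ x ∈ C ∧ C ⊆ P} with h𝒞
  have hPfin : P.Finite := M.ground_finite.subset hP
  have hKfin : K.Finite := hPfin.subset sdiff_subset
  have hKP : K ⊆ P := sdiff_subset
  -- the injection `C ↦ C ∖ L₀` into the 2-subsets of `K`
  have hmap : ∀ C ∈ 𝒞, C \ L₀ ⊆ K ∧ (C \ L₀).ncard = 2 := by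
    intro C hC
    obtain ⟨hCc, hC4, heC, hxC, hCP⟩ := hC
    refine ⟨fun t ht => ⟨hCP ht.1, ht.2⟩, (fourCircuit_inter_closure_pair M hCc hC4 heC hxC hex).2⟩
  have hinj : InjOn (fun C : Set α => C \ L₀) 𝒞 := by
    intro C hC C' hC' hCC'
    simp only at hCC'
    have h1 := (fourCircuit_inter_closure_pair M hC.1 hC.2.1 hC.2.2.1 hC.2.2.2.1 hex).1
    have h2 := (fourCircuit_inter_closure_pair M hC'.1 hC'.2.1 hC'.2.2.1 hC'.2.2.2.1 hex).1
    have hC_eq : C = (C ∩ L₀) ∪ (C \ L₀) := (inter_union_sdiff C L₀).symm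
    have hC'_eq : C' = (C' ∩ L₀) ∪ (C' \ L₀) := (inter_union_sdiff C' L₀).symm
    rw [hC_eq, hC'_eq, h1, h2, hCC']
  have hcount : 𝒞.ncard ≤ K.ncard.choose 2 := by
    rw [← ncard_pairs K hKfin]
    exact ncard_le_ncard_of_injOn (fun C : Set α => C \ L₀) (fun C hC => hmap C hC) hinj
      ((hKfin.finite_subsets).subset (fun S hS => hS.1))
  -- `K` has 2, 3 or 4 points
  obtain ⟨C₀, hC₀⟩ := hne
  have hK2 : 2 ≤ K.ncard := by
    have := (hmap C₀ hC₀)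
    have := ncard_le_ncard this.1 hKfin
    omega
  have hL₀2 : 2 ≤ L₀.ncard := by
    have : ({e, x} : Set α) ⊆ L₀ := M.subset_closure _ (by
      intro t ht; simp only [mem_insert_iff, mem_singleton_iff] at ht
      rcases ht with rfl | rfl
      · exact hC₀.1.subset_ground hC₀.2.2.1
      · exact hC₀.1.subset_ground hC₀.2.2.2.1)
    have := ncard_le_ncard this (hPfin.subset hL)
    rw [ncard_pair hex] at this
    exact this
  have hP6 : P.ncard ≤ 6 := ThmN.ncard_le_six_of_eRk_le_three_of_free M hfree hP hrP
  have hKL : K.ncard + L₀.ncard = P.ncard := by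
    rw [hK]; exact ncard_sdiff_add_ncard_of_subset hL hPfin
  have hK4 : K.ncard ≤ 4 := by omega
  rcases Nat.lt_or_ge K.ncard 4 with hlt | hge
  · -- `|K| = 2` or `3`: the binomial bound suffices
    rcases Nat.lt_or_ge K.ncard 3 with hlt3 | hge3
    · have h2 : K.ncard = 2 := by omega
      rw [h2] at hcount; simp at hcount; omega
    · have h3 : K.ncard = 3 := by omega
      rw [h3] at hcount; simp at hcount; omega
  · -- `|K| = 4`: `P` has 6 points and `L₀ = {e, x}`; two pairs of `K` carry no circuit
    have hK4' : K.ncard = 4 := by omega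
    have hP6' : P.ncard = 6 := by omega
    have hL₀2' : L₀.ncard = 2 := by omega
    have hL₀eq : L₀ = {e, x} := by
      have hsub : ({e, x} : Set α) ⊆ L₀ := M.subset_closure _ (by
        intro t ht; simp only [mem_insert_iff, mem_singleton_iff] at ht
        rcases ht with rfl | rfl
        · exact hC₀.1.subset_ground hC₀.2.2.1
        · exact hC₀.1.subset_ground hC₀.2.2.2.1)
      exact (eq_of_subset_of_ncard_le hsub (by rw [ncard_pair hex, hL₀2']) (hPfin.subset hL)).symm
    have heP : e ∈ P := hL (by rw [hL₀eq]; simp)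
    have hxP : x ∈ P := hL (by rw [hL₀eq]; simp)
    -- a rank-2 triple through `e` and one through `x`, inside `P`
    obtain ⟨u, huP, v, hvP, huv, hue, hve, hruv⟩ := exists_triple_through_of_ncard_six M hfree hP hrP hP6' heP
    obtain ⟨u', hu'P, v', hv'P, hu'v', hu'x, hv'x, hru'v'⟩ :=
      exists_triple_through_of_ncard_six M hfree hP hrP hP6' hxP
    -- their pairs lie in `K`: a point of `{e, x}` other than `z` on a rank-2 triple `{z, y, w}` with `z ∈ {e, x}`
    -- would put `w ∈ cl {e, x} = {e, x}`, impossible for `w ∉ {z, y}`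
    have hexE : ({e, x} : Set α) ⊆ M.E := by
      intro t ht; simp only [mem_insert_iff, mem_singleton_iff] at ht
      rcases ht with rfl | rfl
      · exact hP heP
      · exact hP hxP
    have hr2 : (2 : ℕ∞) ≤ M.eRk {e, x} :=
      ThmN.two_le_eRk_of_two_le_ncard_of_free M hfree hexE (by rw [ncard_pair hex])
    have hnotL : ∀ y z w : α, y ∈ P → w ∈ P → M.eRk {z, y, w} ≤ 2 → y ≠ z → w ≠ z → y ≠ w →
        (z = e ∨ z = x) → y ∉ L₀ := by
      intro y z w hyP hwP hr hyz hwz hyw hz hyL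
      have hyex : y = e ∨ y = x := by
        rw [hL₀eq] at hyL; simpa using hyL
      have hzy : ({e, x} : Set α) ⊆ {z, y, w} := by
        intro t ht
        simp only [mem_insert_iff, mem_singleton_iff] at ht ⊢
        rcases hz with rfl | rfl
        · rcases hyex with rfl | rfl
          · exact absurd rfl hyz
          · rcases ht with rfl | rfl
            · exact Or.inl rfl
            · exact Or.inr (Or.inl rfl)
        · rcases hyex with rfl | rfl
          · rcases ht with rfl | rfl
            · exact Or.inr (Or.inl rfl)
            · exact Or.inl rfl
          · exact absurd rfl hyz
      have hzywE : ({z, y, w} : Set α) ⊆ M.E := by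
        intro t ht; simp only [mem_insert_iff, mem_singleton_iff] at ht
        rcases ht with rfl | rfl | rfl
        · rcases hz with rfl | rfl
          · exact hP heP
          · exact hP hxP
        · exact hP hyP
        · exact hP hwP
      have h1 : M.closure {e, x} = M.closure {z, y, w} :=
        (M.isRkFinite_of_finite (toFinite _)).closure_eq_closure_of_subset_of_eRk_ge_eRk hzy (hr.trans hr2)
      have hwL : w ∈ L₀ := by
        rw [hL₀, h1]
        exact M.subset_closure _ hzywE (by simp)
      rw [hL₀eq] at hwL
      simp only [mem_insert_iff, mem_singleton_iff] at hwL
      rcases hz with rfl | rfl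
      · rcases hyex with rfl | rfl
        · exact hyz rfl
        · rcases hwL with rfl | rfl
          · exact hwz rfl
          · exact hyw rfl
      · rcases hyex with rfl | rfl
        · rcases hwL with rfl | rfl
          · exact hyw rfl
          · exact hwz rfl
        · exact hyz rfl
    have huK : u ∈ K := ⟨huP, hnotL u e v huP hvP hruv hue hve huv (Or.inl rfl)⟩
    have hvK : v ∈ K := by
      refine ⟨hvP, hnotL v e u hvP huP ?_ hve hue huv.symm (Or.inl rfl)⟩
      have : ({e, v, u} : Set α) = {e, u, v} := by ext t; simp only [mem_insert_iff, mem_singleton_iff]; tauto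
      rw [this]; exact hruv
    have hu'K : u' ∈ K := ⟨hu'P, hnotL u' x v' hu'P hv'P hru'v' hu'x hv'x hu'v' (Or.inr rfl)⟩
    have hv'K : v' ∈ K := by
      refine ⟨hv'P, hnotL v' x u' hv'P hu'P ?_ hv'x hu'x hu'v'.symm (Or.inr rfl)⟩
      have : ({x, v', u'} : Set α) = {x, u', v'} := by ext t; simp only [mem_insert_iff, mem_singleton_iff]; tauto
      rw [this]; exact hru'v'
    -- the two pairs are distinct
    have hpairs_ne : ({u, v} : Set α) ≠ {u', v'} := by
      intro hEq
      -- then `{e, u, v}` and `{x, u, v}` are rank-2 triples sharing `u, v`: equal, so `e = x`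
      have hT' : M.eRk {x, u, v} ≤ 2 := by rw [hEq]; exact hru'v'
      have hTE : ({e, u, v} : Set α) ⊆ M.E := by
        intro t ht; simp only [mem_insert_iff, mem_singleton_iff] at ht
        rcases ht with rfl | rfl | rfl; exact hP heP; exact hP huP; exact hP hvP
      have hT'E : ({x, u, v} : Set α) ⊆ M.E := by
        intro t ht; simp only [mem_insert_iff, mem_singleton_iff] at ht
        rcases ht with rfl | rfl | rfl; exact hP hxP; exact hP huP; exact hP hvP
      have h3 : ({e, u, v} : Set α).ncard = 3 := ncard_eq_three.2 ⟨e, u, v, hue.symm, hve.symm, huv, rfl⟩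
      have hux : u ≠ x := fun h => huK.2 (by rw [hL₀eq, h]; simp)
      have hvx : v ≠ x := fun h => hvK.2 (by rw [hL₀eq, h]; simp)
      have h3' : ({x, u, v} : Set α).ncard = 3 := ncard_eq_three.2 ⟨x, u, v, hux.symm, hvx.symm, huv, rfl⟩
      have hTne : ({e, u, v} : Set α) ≠ {x, u, v} := by
        intro h
        have : e ∈ ({x, u, v} : Set α) := h ▸ (by simp)
        simp only [mem_insert_iff, mem_singleton_iff] at this
        rcases this with h' | h' | h'
        · exact hex h'
        · exact hue h'.symm
        · exact hve h'.symm
      have hint := inter_ncard_le_one_of_triples M hfree hTE hT'E hruv hT' h3 h3' hTne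
      have huv_sub : ({u, v} : Set α) ⊆ {e, u, v} ∩ {x, u, v} := by
        intro t ht; simp only [mem_insert_iff, mem_singleton_iff] at ht
        rcases ht with rfl | rfl
        · exact ⟨by simp, by simp⟩
        · exact ⟨by simp, by simp⟩
      have := ncard_le_ncard huv_sub ((toFinite ({e, u, v} : Set α)).inter_of_left _)
      rw [ncard_pair huv] at this
      omega
    -- no circuit through `e, x` in `P` has pair `{u, v}` or `{u', v'}`
    have hkill : ∀ C ∈ 𝒞, C \ L₀ ≠ {u, v} ∧ C \ L₀ ≠ {u', v'} := by
      intro C hC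
      obtain ⟨hCc, hC4, heC, hxC, hCP⟩ := hC
      constructor
      · intro hEq
        have huC : u ∈ C \ L₀ := by rw [hEq]; simp
        have hvC : v ∈ C \ L₀ := by rw [hEq]; simp
        have hT : ({e, u, v} : Set α) ⊆ C := by
          intro t ht; simp only [mem_insert_iff, mem_singleton_iff] at ht
          rcases ht with rfl | rfl | rfl
          · exact heC
          · exact huC.1
          · exact hvC.1
        have hTss : ({e, u, v} : Set α) ⊂ C := by
          refine ⟨hT, fun hCT => ?_⟩
          have : C.ncard ≤ ({e, u, v} : Set α).ncard := ncard_le_ncard hCT (toFinite _)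
          rw [ncard_eq_three.2 ⟨e, u, v, hue.symm, hve.symm, huv, rfl⟩] at this
          omega
        have hind := hCc.ssubset_indep hTss
        have h3 : ({e, u, v} : Set α).ncard = 3 := ncard_eq_three.2 ⟨e, u, v, hue.symm, hve.symm, huv, rfl⟩
        have hrk : M.eRk {e, u, v} = 3 := by
          rw [hind.eRk_eq_encard, ← Set.Finite.cast_ncard_eq (toFinite _), h3]; rfl
        rw [hrk] at hruv
        exact absurd hruv (by decide)
      · intro hEq
        have hu'C : u' ∈ C \ L₀ := by rw [hEq]; simp
        have hv'C : v' ∈ C \ L₀ := by rw [hEq]; simp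
        have hT : ({x, u', v'} : Set α) ⊆ C := by
          intro t ht; simp only [mem_insert_iff, mem_singleton_iff] at ht
          rcases ht with rfl | rfl | rfl
          · exact hxC
          · exact hu'C.1
          · exact hv'C.1
        have hTss : ({x, u', v'} : Set α) ⊂ C := by
          refine ⟨hT, fun hCT => ?_⟩
          have : C.ncard ≤ ({x, u', v'} : Set α).ncard := ncard_le_ncard hCT (toFinite _)
          rw [ncard_eq_three.2 ⟨x, u', v', hu'x.symm, hv'x.symm, hu'v', rfl⟩] at this
          omega
        have hind := hCc.ssubset_indep hTss
        have h3 : ({x, u', v'} : Set α).ncard = 3 := ncard_eq_three.2 ⟨x, u', v', hu'x.symm, hv'x.symm, hu'v', rfl⟩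
        have hrk : M.eRk {x, u', v'} = 3 := by
          rw [hind.eRk_eq_encard, ← Set.Finite.cast_ncard_eq (toFinite _), h3]; rfl
        rw [hrk] at hru'v'
        exact absurd hru'v' (by decide)
    -- count: the image avoids two pairs of `K`
    have huvK : ({u, v} : Set α) ⊆ K := by
      intro t ht; simp only [mem_insert_iff, mem_singleton_iff] at ht
      rcases ht with rfl | rfl
      · exact huK
      · exact hvK
    have hu'v'K : ({u', v'} : Set α) ⊆ K := by
      intro t ht; simp only [mem_insert_iff, mem_singleton_iff] at ht
      rcases ht with rfl | rfl
      · exact hu'K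
      · exact hv'K
    have hpairsK : ({ {u, v}, {u', v'} } : Set (Set α)) ⊆ {S : Set α | S ⊆ K ∧ S.ncard = 2} := by
      intro S hS
      simp only [mem_insert_iff, mem_singleton_iff] at hS
      rcases hS with rfl | rfl
      · exact ⟨huvK, ncard_pair huv⟩
      · exact ⟨hu'v'K, ncard_pair hu'v'⟩
    have hcount' : 𝒞.ncard ≤ ({S : Set α | S ⊆ K ∧ S.ncard = 2} \ { {u, v}, {u', v'} }).ncard := by
      refine ncard_le_ncard_of_injOn (fun C : Set α => C \ L₀) ?_ hinj
        (((hKfin.finite_subsets).subset (fun S hS => hS.1)).subset sdiff_subset)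
      intro C hC
      refine ⟨hmap C hC, ?_⟩
      simp only [mem_insert_iff, mem_singleton_iff, not_or]
      exact hkill C hC
    rw [ncard_sdiff hpairsK (toFinite _), ncard_pairs K hKfin, hK4', ncard_pair hpairs_ne] at hcount'
    have h6 : Nat.choose 4 2 = 6 := by decide
    rw [h6] at hcount'
    omega

end S1

end PercRepro
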